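import Summits.Ventures.PercRepro.Night2ShadowAverage

/-!
# PercRepro — the averaging identity over the hull (night-2, gen 5)

The identity of `Night2ShadowAverage.lean` holds for any family `𝒯` of subsets of the ground set in place of the members;
applied to the hull it gives `Σ_{x ∈ E} (q + 1)·directHull(x) = Σ_{T ∈ hull 𝒜} c(T)·(#E − #T + q)` (`sum_directHull`), hence
the shadow condition for every family whose hull is large in the weighted sense `Σ_{T ∈ hull} c(T)(#E − #T + q) ≥ (q + 2)·#E·#𝒜`
(`shadow_card_of_hull_bound`) — the «averaged selection», which the census of `proofs/NIGHT-2-shadow.md` §9(b)/(e) shows to hold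
on most but not all mixed families (the selection of `x` is essential in the rest).
-/

namespace PercRepro.Shadow

open Finset PerFlat ThmH

variable {α : Type*} [DecidableEq α] {M : Matroid α} [M.Finite]

/-- The direct expression at `x` for an arbitrary family `𝒯` of subsets of the ground set. -/
noncomputable def directOf (M : Matroid α) [M.Finite] (q : ℕ) (𝒯 : Finset (Finset α)) (x : α) : ℚ :=
  ((𝒯.filter (fun T => x ∉ clF M T)).card : ℚ) +
    ((∑ T ∈ 𝒯.filter (fun T => x ∉ T), ((gr M \ clF M T).erase x).card : ℕ) : ℚ) / (q + 1)

/-- `directHull` is `directOf` on the hull. -/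
theorem directHull_eq_directOf (q : ℕ) (𝒜 : Finset (Finset α)) (x : α) :
    directHull M q 𝒜 x = directOf M q (hull M 𝒜) x := rfl

/-- **The averaging identity for an arbitrary family of ground subsets.** -/
theorem sum_directOf (q : ℕ) {𝒯 : Finset (Finset α)} (h𝒯 : ∀ T ∈ 𝒯, T ⊆ gr M) :
    ∑ x ∈ gr M, ((q : ℚ) + 1) * directOf M q 𝒯 x =
      ∑ T ∈ 𝒯, ((coclosureCard M T : ℕ) : ℚ) * (((gr M).card : ℚ) - (T.card : ℚ) + q) := by
  classical
  have hq1 : ((q : ℚ) + 1) ≠ 0 := by positivity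
  have hexp : ∀ x, ((q : ℚ) + 1) * directOf M q 𝒯 x =
      ∑ T ∈ 𝒯, ((if x ∉ clF M T then ((q : ℚ) + 1) else 0) +
        (if x ∉ T then (((gr M \ clF M T).erase x).card : ℚ) else 0)) := by
    intro x
    unfold directOf
    rw [mul_add, mul_div_cancel₀ _ hq1, Finset.card_eq_sum_ones, Finset.sum_filter, Finset.sum_filter,
      Nat.cast_sum, Nat.cast_sum, Finset.mul_sum, ← Finset.sum_add_distrib]
    apply Finset.sum_congr rfl
    intro T _
    split_ifs <;> simp
  simp_rw [hexp]
  rw [Finset.sum_comm]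
  apply Finset.sum_congr rfl
  intro T hT
  rw [Finset.sum_add_distrib, ← Finset.sum_filter, ← Finset.sum_filter]
  have hTg := h𝒯 T hT
  have hTcl : T ⊆ clF M T := by
    rw [← Finset.coe_subset, coe_clF]
    exact M.subset_closure _ (by rw [← coe_gr]; exact_mod_cast hTg)
  have h1 : (gr M).filter (fun x => x ∉ clF M T) = gr M \ clF M T := by
    ext x; simp [Finset.mem_sdiff]
  have hc : ((gr M).filter (fun x => x ∉ clF M T)).card = coclosureCard M T := by
    rw [h1]; rfl
  have h2 : ∀ x ∈ (gr M).filter (fun x => x ∉ T),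
      (((gr M \ clF M T).erase x).card : ℚ) = (coclosureCard M T : ℚ) - (if x ∉ clF M T then 1 else 0) := by
    intro x hx
    unfold coclosureCard
    by_cases hxc : x ∈ clF M T
    · rw [if_neg (by simpa using hxc), sub_zero, Finset.erase_eq_of_notMem]
      simp [Finset.mem_sdiff, hxc]
    · rw [if_pos hxc, Finset.card_erase_of_mem (by rw [Finset.mem_sdiff]; exact ⟨(Finset.mem_filter.1 hx).1, hxc⟩)]
      have : 1 ≤ (gr M \ clF M T).card :=
        Finset.card_pos.2 ⟨x, by rw [Finset.mem_sdiff]; exact ⟨(Finset.mem_filter.1 hx).1, hxc⟩⟩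
      push_cast [Nat.cast_sub this]
      ring
  rw [Finset.sum_congr rfl h2, Finset.sum_sub_distrib, Finset.sum_const, ← Finset.sum_filter]
  have h3 : ((gr M).filter (fun x => x ∉ T)).filter (fun x => x ∉ clF M T) = gr M \ clF M T := by
    ext x
    simp only [Finset.mem_filter, Finset.mem_sdiff]
    constructor
    · rintro ⟨⟨h1, -⟩, h2⟩; exact ⟨h1, h2⟩
    · rintro ⟨h1, h2⟩; exact ⟨⟨h1, fun h => h2 (hTcl h)⟩, h2⟩
  have h4 : (gr M).filter (fun x => x ∉ T) = gr M \ T := by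
    ext x; simp [Finset.mem_sdiff]
  rw [h3, Finset.sum_const, h4, Finset.card_sdiff_of_subset hTg]
  have hcard : T.card ≤ (gr M).card := Finset.card_le_card hTg
  simp only [Finset.sum_const, nsmul_eq_mul, mul_one]
  rw [hc]
  have hcc : (((gr M \ clF M T).card : ℕ) : ℚ) = ((coclosureCard M T : ℕ) : ℚ) := rfl
  rw [hcc]
  push_cast [Nat.cast_sub hcard]
  ring

/-- **The averaging identity over the hull**: `Σ_{x ∈ E} (q + 1)·directHull(x) = Σ_{T ∈ hull 𝒜} c(T)·(#E − #T + q)`. -/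
theorem sum_directHull {q : ℕ} {𝒜 : Finset (Finset α)} (h𝒜 : 𝒜 ⊆ Uq M (q + 2) q) :
    ∑ x ∈ gr M, ((q : ℚ) + 1) * directHull M q 𝒜 x =
      ∑ T ∈ hull M 𝒜, ((coclosureCard M T : ℕ) : ℚ) * (((gr M).card : ℚ) - (T.card : ℚ) + q) := by
  simp_rw [directHull_eq_directOf]
  exact sum_directOf q (fun T hT => (hull_facts h𝒜 hT).1)

/-- **The averaged selection**: if the hull is large in the weighted sense, the shadow condition holds. -/
theorem shadow_card_of_hull_bound {q : ℕ} {𝒜 : Finset (Finset α)} (h𝒜 : 𝒜 ⊆ Uq M (q + 2) q)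
    (hE : (gr M).Nonempty)
    (hhull : ((q : ℚ) + 2) * ((gr M).card : ℚ) * (𝒜.card : ℚ) ≤
      ∑ T ∈ hull M 𝒜, ((coclosureCard M T : ℕ) : ℚ) * (((gr M).card : ℚ) - (T.card : ℚ) + q)) :
    ((q + 2 : ℚ) / (q + 1)) * (𝒜.card : ℚ) ≤ ((shadow M (q + 2) q 𝒜).card : ℚ) := by
  classical
  obtain ⟨x, hx, hmax⟩ := Finset.exists_max_image (gr M) (fun x => ((q : ℚ) + 1) * directHull M q 𝒜 x) hE
  have hsum := sum_directHull (M := M) h𝒜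
  have havg : ∑ T ∈ hull M 𝒜, ((coclosureCard M T : ℕ) : ℚ) * (((gr M).card : ℚ) - (T.card : ℚ) + q) ≤
      ((gr M).card : ℚ) * (((q : ℚ) + 1) * directHull M q 𝒜 x) := by
    rw [← hsum]
    calc ∑ y ∈ gr M, ((q : ℚ) + 1) * directHull M q 𝒜 y
        ≤ ∑ _y ∈ gr M, ((q : ℚ) + 1) * directHull M q 𝒜 x := Finset.sum_le_sum (fun y hy => hmax y hy)
      _ = ((gr M).card : ℚ) * (((q : ℚ) + 1) * directHull M q 𝒜 x) := by simp
  have hn : (0 : ℚ) < ((gr M).card : ℚ) := by exact_mod_cast Finset.card_pos.2 hE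
  have hq1 : (0 : ℚ) < (q : ℚ) + 1 := by positivity
  have hD := directHull_le_card_shadow h𝒜 hx
  have h1 : ((q : ℚ) + 2) * (𝒜.card : ℚ) ≤ ((q : ℚ) + 1) * directHull M q 𝒜 x := by
    have := le_trans hhull havg
    nlinarith
  rw [div_mul_eq_mul_div, div_le_iff₀ hq1]
  nlinarith

end PercRepro.Shadow
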